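import Summits.QuantumAdvantage.QuantumAdvantage.Theorems.HankelLiftBeyondRectanglesUniform
import HarnessLib

/-!
# Route HankelLift, crux `BeyondRectangles` (stmt-QuantumAdvantage-18440): the weakest lift-free form —
# i.o. unpredictability of the Liouville sign by PPT

`HankelLiftBeyondRectangles.lean` / `HankelLiftBeyondRectanglesUniform.lean` reduce the hypothesis-type crux
`HankelLift.BeyondRectangles` (and, with the route's theorems, the summit) to two-sided CORRELATION bounds
(`LiouvilleBPPDark`, `UniformLiouvilleBPPDark`: `|corr| ≤ ε` infinitely often).  The crux itself is ONE-sided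
(an upper bound on a success probability), and so is what the composition really uses.  This file records the
weakest statement of the chain, in the crux's own success-probability language but with no pairs, no rectangles
and no lift:

* `predSuccess B n = Σ_{m<2ⁿ⁺¹} Pr[B(encSum n m) = [λ(m+2) = −1]]` — the total success of a single-integer
  predictor in GUESSING THE LIOUVILLE SIGN of a uniform `(n+1)`-bit integer;
* `LiouvilleBPPUnpredictable : Prop` — for every PPT `B` there are infinitely many `n` with
  `predSuccess B n ≤ 2ⁿ⁺¹·(1/2 + 1/24)`: "no probabilistic polynomial-time algorithm guesses the Liouville sign
  `λ(m+2)` of a uniform `(n+1)`-bit integer `m` with advantage `1/24` for all large `n`" (weak average-case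
  unpredictability, i.o.; implied by `UniformLiouvilleBPPDark`, `unpredictable_of_uniformDark`);
* `predSuccess_eq : predSuccess B n = 2ⁿ⁺¹/2 − uniformCorr B n / 2` (calibration per integer);
* `beyondRectangles_of_sumCorr_lower` — the registered composition needs only the ONE-sided bound
  `−4ⁿ/6 ≤ sumCorr B n` infinitely often (perfect prediction is `pairCorr = −4ⁿ`);
* `beyondRectangles_of_liouvilleBPPUnpredictable`, `quantumAdvantage_of_liouvilleBPPUnpredictable` — via the
  reweighting gadget (`uniformCorr (reweight B) n = sumCorr B n / 2ⁿ`).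

So: QuantumAdvantage ⟸ "the Liouville sign of a random `(n+1)`-bit integer cannot be guessed by any PPT with
advantage `1/24` for all large `n`" — kernel-checked, hypotheses verbatim, no sorry.

WHAT THIS IS NOT: `LiouvilleBPPUnpredictable` is OPEN (hypothesis-type: an average-case hardness statement for `λ`
against uniform probabilistic polynomial time, stronger than worst-case `λ ∉ BPP`; it implies the summit with the
route's theorems, so `Literature.Barriers.QuantumAdvantage.SeparationPrerequisites` applies); separation NOT moved.
-/

-- the sub-problem namespace `Summit.QuantumAdvantage.QuantumAdvantage` repeats the summit name by design (D-0017)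
set_option linter.dupNamespace false

noncomputable section

namespace Summit.QuantumAdvantage.QuantumAdvantage.Theorems.BeyondRectangles

open scoped BigOperators Topology Manifold Classical MeasureTheory ProbabilityTheory Matrix InnerProductSpace ComplexConjugate ContinuousMap
open Filter Set Function TopologicalSpace MeasureTheory
open Literature.QuantumAdvantage
open Literature.Computability.Complexity
open _root_.Computability (encodeBool)
open Summit.QuantumAdvantage.QuantumAdvantage.Theses.HankelLift (BeyondRectangles)

/-! ### Guessing the Liouville sign -/

/-- Total success of the single-integer predictor `B` in guessing the Liouville sign at level `n`:
`predSuccess B n = Σ_{m < 2ⁿ⁺¹} Pr[B(encSum n m) = [λ(m + 2) = −1]] ∈ [0, 2ⁿ⁺¹]`. [cite: BogdanovTrevisan2006, Def. 2.13] -/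
def predSuccess (B : RandAlg (List Bool) Bool) (n : ℕ) : ℝ :=
  ∑ m ∈ Finset.range (2 ^ (n + 1)), B.pr id (encSum n m) {decide (ArithmeticFunction.liouville (m + 2) = -1)}

/-- **`LiouvilleBPPUnpredictable`** — weak average-case unpredictability of the Liouville sign by uniform
probabilistic polynomial time, infinitely often: for every PPT `B` there are infinitely many `n` at which `B`'s
average probability of guessing `[λ(m+2) = −1]` for a uniform `(n+1)`-bit integer `m` is at most `1/2 + 1/24`.
A ROUTE-POSITED OPEN HYPOTHESIS (deliberately no cite tag; nearest print form: Pudlák's "λ pseudorandom against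
P", bib Pudlak2013Pseudorandomness Def. 2, of which it is a one-sided, randomized, constant-advantage, i.o.
weakening); with the route's theorems it implies the summit (`quantumAdvantage_of_liouvilleBPPUnpredictable`). -/
def LiouvilleBPPUnpredictable : Prop :=
  ∀ B : RandAlg (List Bool) Bool, B.IsPolyTime id Computability.encodeBool →
    ∃ᶠ n : ℕ in Filter.atTop, predSuccess B n ≤ (2 : ℝ) ^ (n + 1) * (1 / 2 + 1 / 24)

/-- **Calibration per integer**: `Pr[B(w) = [λ(m+2) = −1]] = 1/2 − λ(m+2)·(2·Pr[B(w) = true] − 1)/2`. [folklore] -/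
theorem pr_guess_eq (B : RandAlg (List Bool) Bool) (w : List Bool) (m : ℕ) :
    B.pr id w {decide (ArithmeticFunction.liouville (m + 2) = -1)} =
      1 / 2 - ((ArithmeticFunction.liouville (m + 2) : ℤ) : ℝ) * (2 * B.pr id w {true} - 1) / 2 := by
  have hl : ArithmeticFunction.liouville (m + 2) = 1 ∨ ArithmeticFunction.liouville (m + 2) = -1 := by
    rw [ArithmeticFunction.liouville_apply (show m + 2 ≠ 0 by omega)]; exact neg_one_pow_eq_or ℤ _
  rcases hl with h | h
  · have hdec : decide (ArithmeticFunction.liouville (m + 2) = -1) = false := by rw [h]; decide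
    rw [hdec, h]
    have hc := RandAlg.pr_ne_eq_one_sub B id w true
    have hset : ({b : Bool | b ≠ true} : Set Bool) = {false} := by
      ext b; cases b <;> simp
    rw [hset] at hc
    rw [hc]
    push_cast
    ring
  · have hdec : decide (ArithmeticFunction.liouville (m + 2) = -1) = true := by rw [h]; decide
    rw [hdec, h]
    push_cast
    ring

/-- **`predSuccess B n = 2ⁿ⁺¹/2 − uniformCorr B n / 2`.** [folklore] -/
theorem predSuccess_eq (B : RandAlg (List Bool) Bool) (n : ℕ) :
    predSuccess B n = (2 : ℝ) ^ (n + 1) / 2 - uniformCorr B n / 2 := by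
  unfold predSuccess uniformCorr
  rw [Finset.sum_congr rfl fun m _ => pr_guess_eq B (encSum n m) m, Finset.sum_sub_distrib, Finset.sum_const,
    Finset.card_range, ← Finset.sum_div]
  simp only [nsmul_eq_mul]
  push_cast
  ring

/-- Two-sided darkness implies one-sided unpredictability: `UniformLiouvilleBPPDark → LiouvilleBPPUnpredictable`.
[folklore] -/
theorem unpredictable_of_uniformDark (h : UniformLiouvilleBPPDark) : LiouvilleBPPUnpredictable := by
  intro B hB
  refine (h B hB).mono fun n hn => ?_
  rw [predSuccess_eq]
  have := neg_abs_le (uniformCorr B n)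
  linarith

/-! ### The one-sided composition -/

/-- **The crux from a ONE-sided bound**: if every PPT sum-predictor has `−4ⁿ/6 ≤ sumCorr B n` infinitely often,
then `BeyondRectangles` — the registered composition (`beyondRectangles_of_liouvilleBPPDark`) uses only this
direction: `successSum = 4ⁿ/2 − pairCorr/2 ≤ (3/5)·4ⁿ` iff `pairCorr ≥ −4ⁿ/5`. [cite: BogdanovTrevisan2006, Def. 2.13] -/
theorem beyondRectangles_of_sumCorr_lower
    (h₁ : ∀ B : RandAlg (List Bool) Bool, B.IsPolyTime id Computability.encodeBool →
      ∃ᶠ n : ℕ in Filter.atTop, -((4 : ℝ) ^ n / 6) ≤ sumCorr B n) :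
    BeyondRectangles := by
  refine beyondRectangles_iff.2 fun A hA => ?_
  obtain ⟨B, hB, hAB⟩ := stub_antidiagonalSampling A hA
  refine ((h₁ B hB).and_eventually (Filter.eventually_ge_atTop 1)).mono ?_
  rintro n ⟨hdark, hn⟩
  obtain ⟨k, hk, a, b, g, hbase⟩ := rectangleBaseline n hn
  refine ⟨k, hk, a, b, g, ?_⟩
  have hcard : ((Finset.univ : Finset (Fin (2 ^ n) × Fin (2 ^ n))).card : ℝ) = (4 : ℝ) ^ n := by
    rw [card_pairs]; push_cast; rfl
  have hpos : (0 : ℝ) < (4 : ℝ) ^ n := by positivity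
  have hcorr : -((4 : ℝ) ^ n / 5) ≤ pairCorr A n := by
    have habs := (abs_le.1 (hAB n)).1
    linarith
  have hsucc : successSum A n ≤ 3 / 5 * (4 : ℝ) ^ n := by
    have hcal := stub_successCalibration A n
    linarith
  rw [hcard]
  have h1 : successSum A n / (4 : ℝ) ^ n ≤ 3 / 5 := by
    rw [div_le_iff₀ hpos]; linarith
  have h2 : (1 : ℝ) / 2 ≤ (agreeCount n k a b g : ℝ) / (4 : ℝ) ^ n := by
    rw [le_div_iff₀ hpos]; linarith
  linarith

/-- **One-sided bounds transfer along the reweighting gadget**: unpredictability of `reweight B` at level `n`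
gives `−4ⁿ/6 ≤ sumCorr B n`. [folklore] -/
theorem sumCorr_lower_of_unpredictable (h : LiouvilleBPPUnpredictable) :
    ∀ B : RandAlg (List Bool) Bool, B.IsPolyTime id Computability.encodeBool →
      ∃ᶠ n : ℕ in Filter.atTop, -((4 : ℝ) ^ n / 6) ≤ sumCorr B n := by
  intro B hB
  refine (h (reweight B) (reweight_isPolyTime hB)).mono fun n hn => ?_
  rw [predSuccess_eq, uniformCorr_reweight] at hn
  have h2 : (0 : ℝ) < 2 ^ n := by positivity
  have h4 : (4 : ℝ) ^ n = 2 ^ n * 2 ^ n := by rw [← mul_pow]; norm_num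
  -- `hn : 2^{n+1}/2 − (sumCorr B n / 2ⁿ)/2 ≤ 2^{n+1}(1/2 + 1/24)` ⇒ `−2^{n+1}/12 ≤ sumCorr B n / 2ⁿ`
  have hq : -((2 : ℝ) ^ (n + 1) / 12) ≤ sumCorr B n / 2 ^ n := by linarith
  rw [le_div_iff₀ h2] at hq
  rw [h4]
  calc -((2 : ℝ) ^ n * 2 ^ n / 6) = -((2 : ℝ) ^ (n + 1) / 12) * 2 ^ n := by rw [pow_succ]; ring
    _ ≤ sumCorr B n := hq

/-- **The crux from i.o. unpredictability of the Liouville sign.** [cite: BogdanovTrevisan2006, Def. 2.13] -/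
theorem beyondRectangles_of_liouvilleBPPUnpredictable (h : LiouvilleBPPUnpredictable) : BeyondRectangles :=
  beyondRectangles_of_sumCorr_lower (sumCorr_lower_of_unpredictable h)

/-- **The summit from i.o. unpredictability of the Liouville sign**: `QuantumAdvantage` follows from "no PPT
guesses `[λ(m+2) = −1]` for uniform `(n+1)`-bit `m` with advantage `1/24` for all large `n`" — the route's
deciding theorem with its theorem-side binders discharged by the tree and the hypothesis-side binder supplied by
`beyondRectangles_of_liouvilleBPPUnpredictable`.  CONDITIONAL on the open hypothesis; nothing unconditional
about `BPP` is claimed. [cite: AroraBarak2009, Thm. 7.10] -/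
theorem quantumAdvantage_of_liouvilleBPPUnpredictable (h : LiouvilleBPPUnpredictable) : QuantumAdvantage :=
  Summit.QuantumAdvantage.QuantumAdvantage.Theses.HankelLift.closes HankelLift.liouvilleSumMemBQP_proof
    hankelDiscrepancy_proof discToRules_proof (beyondRectangles_of_liouvilleBPPUnpredictable h)

end Summit.QuantumAdvantage.QuantumAdvantage.Theorems.BeyondRectangles

end
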